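import Literature.Analysis.SpecialFunctions.GammaStirlingComplex
import Literature.Analysis.SpecialFunctions.GammaStirlingUniform
import Literature.Analysis.SpecialFunctions.DigammaStirlingSeries
import Literature.Analysis.SpecialFunctions.DigammaLogBound
import HarnessLib

/-!
# The complex Stirling formula (with phase) on the right half-plane `Re s ≥ 1`

Topic `Literature/Analysis/SpecialFunctions`, companion of `GammaStirlingComplex.lean` (the phase
form `Γ(z) = √(2π) exp((z − ½) Log z − z + E)` for `Im z > 0` with an error measured by `Im z`,
`|E| ≤ 1/(12|z|) + (π+1)/(16π (Im z)²)`, which degenerates near the real axis), of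
`GammaStirlingUniform.lean` (the MODULUS form on `Re w > 0`, `GammaStirling.abs_log_norm_Gamma_sub_le`)
and of `DigammaStirlingSeries.lean` (Stirling's series for `ψ` on `Re w > 0`,
`Complex.norm_digamma_sub_stirlingSeries_le`). Everything here is PROVED; there are no definitions
and no named facts (D-0026).

**Theorem** (`exists_Gamma_eq_exp_stirling_of_one_le_re`). For every `s` with `Re s ≥ 1` there is
`E` with `‖E‖ ≤ 1/‖s‖` and `Γ(s) = √(2π) · exp((s − ½) Log s − s + E)` — the first-order complex
Stirling formula (Whittaker–Watson §12.33, §13.6; Titchmarsh, *Theory of Functions* §4.42) with the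
phase, uniformly on the closed half-plane `Re s ≥ 1` (in particular along and near the positive
real axis with unbounded real part, which the `Im z > 0` form does not cover).

Proof. If `|Im s| ≥ ‖s‖/2` the upper-half-plane form (or its conjugate, `Γ(s̄) = conj Γ(s)`,
`Log s̄ = conj Log s` off the negative axis) already has error `≤ (1/12 + (π+1)/(4π))/‖s‖` because
`(Im s)² ≥ ‖s‖²/4 ≥ ‖s‖/4`. If `|Im s| < ‖s‖/2` then `σ = Re s > ‖s‖/2`; write `s = σ + iτ` and
integrate up the vertical segment from the real point `σ`: `Γ(σ + iu) = Γ(σ) exp(i∫₀ᵘ ψ(σ + iv) dv)`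
(`Gamma_vertical_eq_mul_exp_integral`: both sides solve `y' = iψy`), the main term satisfies
`[(z − ½)Log z − z]_{σ}^{σ+iτ} = i∫₀^τ (Log z − 1/(2z))` (`stirlingMain_vertical_eq_integral`), the
real anchor `|log Γ(σ) − ((σ − ½) log σ − σ + ½ log 2π)| ≤ (1/12)(1/σ² + π/(2σ))` is the modulus
form at a real point, and `‖ψ(z) − (Log z − 1/(2z))‖ ≤ (1/(4π) + 1/12)/‖z‖²` on `Re z ≥ 1`
(`norm_digamma_sub_log_add_inv_le`, the case `ν = 1` of the `ψ`-series) integrates to at most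
`(1/(4π) + 1/12) · π/(2σ)` along the segment; altogether `‖E‖ ≤ 0.48/σ < 1/‖s‖`.

Use: the Stirling input "(11)" of Rodgers–Tao 2020 §2 (Forum Math. Pi 8 (2020) e6), Lemma 7
(= arXiv Lemma 2.4), where `Γ(b + iξ)` is needed for `Re b ≥ 1` arbitrary — cell rh-crit C3, fact
`Literature.NumberTheory.LFunctions.rodgersTao_I_stationary`.

## Main results

* `GammaStirling.norm_digamma_sub_log_add_inv_le` — `‖ψ(w) − (Log w − 1/(2w))‖ ≤ (1/(4π) + 1/12)/‖w‖²`
  for `Re w ≥ 1`;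
* `GammaStirling.Gamma_vertical_eq_mul_exp_integral` — `Γ(σ + iu) = Γ(σ) exp(i ∫₀ᵘ ψ(σ + iv) dv)`,
  `σ > 0` (private companions: the same for the main term `(z − ½)Log z − z`, and
  `∫₀ᵘ dv/(σ² + v²) = arctan(u/σ)/σ`);
* `GammaStirling.exists_Gamma_eq_exp_stirling_of_one_le_re` — **the theorem**.

## References

* E. T. Whittaker, G. N. Watson, *A Course of Modern Analysis*, 4th ed. (1927), §12.33, §13.6.
* E. C. Titchmarsh, *The Theory of Functions*, 2nd ed. (1939), §4.42.
* B. Rodgers, T. Tao, *The de Bruijn–Newman constant is non-negative*, Forum Math. Pi 8 (2020) e6,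
  §2 eq. (11) and Lemma 7.
-/

noncomputable section

open Complex Filter Topology Set MeasureTheory intervalIntegral
open scoped Real ComplexConjugate

namespace Literature.Analysis.SpecialFunctions.GammaStirling

open Literature.Analysis.SpecialFunctions.Complex (differentiableOn_Gamma_re_pos
  differentiableOn_digamma continuousOn_digamma norm_digamma_sub_stirlingSeries_le)

/-! ## Stirling for `ψ` to first order on `Re w ≥ 1` -/

/-- `‖ψ(w) − (Log w − 1/(2w))‖ ≤ (1/(4π) + 1/12)/‖w‖²` for `Re w ≥ 1`: the case `ν = 1` of the
`ψ`-series (`norm_digamma_sub_stirlingSeries_le`, remainder `(π²/3)·3!/(2π)³/(‖w‖² Re w) =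
1/(4π ‖w‖² Re w)`) with the term `B₂/(2w²) = 1/(12w²)` moved into the error.
[cite: WhittakerWatson1927, §12.33] -/
theorem norm_digamma_sub_log_add_inv_le {w : ℂ} (hw : 1 ≤ w.re) :
    ‖digamma w - (log w - 1 / (2 * w))‖ ≤ (1 / (4 * π) + 1 / 12) / ‖w‖ ^ 2 := by
  have hw0 : 0 < w.re := by linarith
  have hwn : 1 ≤ ‖w‖ := hw.trans ((le_abs_self _).trans (abs_re_le_norm w))
  have hwn0 : 0 < ‖w‖ := by linarith
  have h := norm_digamma_sub_stirlingSeries_le hw0 (ν := 1) one_ne_zero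
  have hsum : ∑ k ∈ Finset.Icc 1 1, (bernoulli (2 * k) : ℂ) / (2 * k) / w ^ (2 * k) =
      1 / (12 * w ^ 2) := by
    rw [show Finset.Icc 1 1 = {1} from rfl, Finset.sum_singleton]
    rw [show bernoulli (2 * 1) = 1 / 6 by
      rw [bernoulli_eq_bernoulli'_of_ne_one (by norm_num), mul_one, bernoulli'_two]]
    push_cast
    field_simp
    ring
  rw [hsum] at h
  have hK : Real.pi ^ 2 / 3 * ((2 * 1 + 1).factorial : ℝ) / (2 * Real.pi) ^ (2 * 1 + 1) /
      (‖w‖ ^ (2 * 1) * w.re) = 1 / (4 * π) / (‖w‖ ^ 2 * w.re) := by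
    norm_num [Nat.factorial]
    field_simp
    ring
  rw [hK] at h
  -- move `1/(12 w²)` to the error
  have h12 : ‖(1 : ℂ) / (12 * w ^ 2)‖ = 1 / 12 / ‖w‖ ^ 2 := by
    rw [norm_div, norm_one, norm_mul, norm_pow]
    simp
    ring
  have hsplit : digamma w - (log w - 1 / (2 * w)) =
      (digamma w - (log w - 1 / (2 * w) - 1 / (12 * w ^ 2))) - 1 / (12 * w ^ 2) := by ring
  rw [hsplit]
  refine (norm_sub_le _ _).trans ?_
  rw [h12]
  have h1 : 1 / (4 * π) / (‖w‖ ^ 2 * w.re) ≤ 1 / (4 * π) / ‖w‖ ^ 2 := by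
    rw [div_le_div_iff_of_pos_left (by positivity) (by positivity) (by positivity)]
    calc ‖w‖ ^ 2 = ‖w‖ ^ 2 * 1 := (mul_one _).symm
      _ ≤ ‖w‖ ^ 2 * w.re := mul_le_mul_of_nonneg_left hw (by positivity)
  calc ‖digamma w - (log w - 1 / (2 * w) - 1 / (12 * w ^ 2))‖ + 1 / 12 / ‖w‖ ^ 2
      ≤ 1 / (4 * π) / ‖w‖ ^ 2 + 1 / 12 / ‖w‖ ^ 2 := add_le_add (h.trans h1) le_rfl
    _ = (1 / (4 * π) + 1 / 12) / ‖w‖ ^ 2 := by ring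

/-! ## The vertical primitive of `ψ` -/

/-- `u ↦ ψ(σ + iu)` is continuous for `σ > 0`. [folklore] -/
private theorem continuous_digamma_vertical {σ : ℝ} (hσ : 0 < σ) :
    Continuous fun u : ℝ ↦ digamma ((σ : ℂ) + u * I) := by
  have hline : Continuous fun u : ℝ ↦ (σ : ℂ) + u * I := by fun_prop
  refine continuousOn_digamma.comp_continuous hline fun u ↦ ?_
  show 0 < ((σ : ℂ) + u * I).re
  simpa using hσ

/-- `u ↦ Γ(σ + iu)` has derivative `i Γ'(σ + iu)` (`σ > 0`). [folklore] -/
private theorem hasDerivAt_Gamma_vertical {σ : ℝ} (hσ : 0 < σ) (u : ℝ) :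
    HasDerivAt (fun u : ℝ ↦ Gamma ((σ : ℂ) + u * I))
      (deriv Gamma ((σ : ℂ) + u * I) * I) u := by
  have hz : 0 < ((σ : ℂ) + u * I).re := by simpa using hσ
  have hG : DifferentiableAt ℂ Gamma ((σ : ℂ) + u * I) :=
    (differentiableOn_Gamma_re_pos _ hz).differentiableAt
      ((isOpen_lt continuous_const Complex.continuous_re).mem_nhds hz)
  -- complex chain rule for `w ↦ Γ(σ + wI)`, then restriction to real `w`
  have he : HasDerivAt (fun w : ℂ ↦ Gamma ((σ : ℂ) + w * I))
      (deriv Gamma ((σ : ℂ) + u * I) * I) (u : ℂ) := by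
    have hin : HasDerivAt (fun w : ℂ ↦ (σ : ℂ) + w * I) I (u : ℂ) := by
      simpa using ((hasDerivAt_id (u : ℂ)).mul_const I).const_add (σ : ℂ)
    exact hG.hasDerivAt.comp (u : ℂ) hin
  exact he.comp_ofReal

/-- **`Γ` along a vertical segment**: for `σ > 0` and real `u`,
`Γ(σ + iu) = Γ(σ) · exp(i ∫₀ᵘ ψ(σ + iv) dv)` — the integrated form of `ψ(z) = (d/dz) log Γ(z)`
(Whittaker–Watson §12.3) along the segment (both sides solve `y' = iψ(σ + iu) y` with the same
value at `u = 0`). [cite: WhittakerWatson1927, §12.3] -/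
theorem Gamma_vertical_eq_mul_exp_integral {σ : ℝ} (hσ : 0 < σ) (u : ℝ) :
    Gamma ((σ : ℂ) + u * I) =
      Gamma σ * exp (I * ∫ v in (0 : ℝ)..u, digamma ((σ : ℂ) + v * I)) := by
  set ψv : ℝ → ℂ := fun v ↦ digamma ((σ : ℂ) + v * I) with hψv
  have hψc : Continuous ψv := continuous_digamma_vertical hσ
  -- `F(u) = Γ(σ+iu) exp(-i ∫₀ᵘ ψ)` is constant
  have hint : ∀ u, HasDerivAt (fun u : ℝ ↦ ∫ v in (0 : ℝ)..u, ψv v) (ψv u) u := fun u ↦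
    intervalIntegral.integral_hasDerivAt_right (hψc.intervalIntegrable _ _)
      (hψc.stronglyMeasurableAtFilter _ _) hψc.continuousAt
  have hderiv : ∀ u, HasDerivAt
      (fun u : ℝ ↦ Gamma ((σ : ℂ) + u * I) * exp (-(I * ∫ v in (0 : ℝ)..u, ψv v))) 0 u := by
    intro u
    have hz : 0 < ((σ : ℂ) + u * I).re := by simpa using hσ
    have hΓ0 : Gamma ((σ : ℂ) + u * I) ≠ 0 := Complex.Gamma_ne_zero_of_re_pos hz
    have h1 := hasDerivAt_Gamma_vertical hσ u
    have h2 : HasDerivAt (fun u : ℝ ↦ exp (-(I * ∫ v in (0 : ℝ)..u, ψv v)))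
        (exp (-(I * ∫ v in (0 : ℝ)..u, ψv v)) * (-(I * ψv u))) u :=
      ((hint u).const_mul I).neg.cexp
    have h12 := h1.mul h2
    refine h12.congr_deriv ?_
    -- the derivative vanishes: `Γ' = ψ Γ`
    have hψ : ψv u * Gamma ((σ : ℂ) + u * I) = deriv Gamma ((σ : ℂ) + u * I) := by
      simp only [hψv, Complex.digamma_def, logDeriv_apply]
      field_simp
    rw [← hψ]
    ring
  have hdiff : Differentiable ℝ
      (fun u : ℝ ↦ Gamma ((σ : ℂ) + u * I) * exp (-(I * ∫ v in (0 : ℝ)..u, ψv v))) :=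
    fun u ↦ (hderiv u).differentiableAt
  have hconst := is_const_of_deriv_eq_zero hdiff (fun u ↦ (hderiv u).deriv) u 0
  simp only [Complex.ofReal_zero, zero_mul, add_zero, intervalIntegral.integral_same, mul_zero,
    neg_zero, Complex.exp_zero, mul_one] at hconst
  -- solve for `Γ(σ+iu)`
  calc Gamma ((σ : ℂ) + u * I)
      = Gamma ((σ : ℂ) + u * I) * exp (-(I * ∫ v in (0 : ℝ)..u, ψv v)) *
          exp (I * ∫ v in (0 : ℝ)..u, ψv v) := by
        rw [mul_assoc, ← Complex.exp_add, neg_add_cancel, Complex.exp_zero, mul_one]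
    _ = Gamma σ * exp (I * ∫ v in (0 : ℝ)..u, ψv v) := by rw [hconst]

/-- The Stirling main term along the same segment:
`[(z − ½) Log z − z]_{z = σ}^{z = σ + iu} = i ∫₀ᵘ (Log(σ + iv) − 1/(2(σ + iv))) dv` (`σ > 0`).
[folklore] -/
private theorem stirlingMain_vertical_eq_integral {σ : ℝ} (hσ : 0 < σ) (u : ℝ) :
    ((((σ : ℂ) + u * I) - 1 / 2) * log ((σ : ℂ) + u * I) - ((σ : ℂ) + u * I)) -
        (((σ : ℂ) - 1 / 2) * log (σ : ℂ) - σ) =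
      I * ∫ v in (0 : ℝ)..u, (log ((σ : ℂ) + v * I) - 1 / (2 * ((σ : ℂ) + v * I))) := by
  set S : ℂ → ℂ := fun z ↦ (z - 1 / 2) * log z - z with hS
  set g : ℝ → ℂ := fun v ↦ log ((σ : ℂ) + v * I) - 1 / (2 * ((σ : ℂ) + v * I)) with hg
  have hgc : Continuous g := by
    have hline : Continuous fun v : ℝ ↦ (σ : ℂ) + v * I := by fun_prop
    have hslit : ∀ v : ℝ, (σ : ℂ) + v * I ∈ slitPlane := fun v ↦
      Or.inl (by simpa using hσ)
    have hne : ∀ v : ℝ, (σ : ℂ) + v * I ≠ 0 := fun v ↦ slitPlane_ne_zero (hslit v)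
    refine Continuous.sub ?_ ?_
    · exact Continuous.clog hline hslit
    · exact continuous_const.div (continuous_const.mul hline)
        fun v ↦ mul_ne_zero two_ne_zero (hne v)
  have hderiv : ∀ v : ℝ, HasDerivAt (fun v : ℝ ↦ S ((σ : ℂ) + v * I)) (I * g v) v := by
    intro v
    set z : ℂ := (σ : ℂ) + v * I with hz
    have hslit : z ∈ slitPlane := Or.inl (by simp [hz, hσ])
    have hz0 : z ≠ 0 := slitPlane_ne_zero hslit
    have hS' : HasDerivAt S (log z - 1 / (2 * z)) z := by
      have h1 : HasDerivAt (fun z : ℂ ↦ (z - 1 / 2) * log z) (1 * log z + (z - 1 / 2) * z⁻¹) z :=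
        ((hasDerivAt_id z).sub_const _).mul (Complex.hasDerivAt_log hslit)
      have h2 := h1.sub (hasDerivAt_id z)
      refine h2.congr_deriv ?_
      field_simp
      ring
    have hin : HasDerivAt (fun w : ℂ ↦ (σ : ℂ) + w * I) I (v : ℂ) := by
      simpa using ((hasDerivAt_id (v : ℂ)).mul_const I).const_add (σ : ℂ)
    have hcomp := (hS'.comp (v : ℂ) hin).comp_ofReal
    simpa [hg, hz, mul_comm] using hcomp
  have h := intervalIntegral.integral_eq_sub_of_hasDerivAt (a := 0) (b := u)
    (fun v _ ↦ hderiv v) ((hgc.const_mul I).intervalIntegrable _ _)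
  simp only [hS, Complex.ofReal_zero, zero_mul, add_zero] at h
  rw [intervalIntegral.integral_const_mul] at h
  rw [← h]

/-- `∫₀ᵘ dv/(σ² + v²) = arctan(u/σ)/σ` (`σ > 0`). [folklore] -/
private theorem integral_inv_sq_add_sq {σ : ℝ} (hσ : 0 < σ) (u : ℝ) :
    ∫ v in (0 : ℝ)..u, 1 / (σ ^ 2 + v ^ 2) = Real.arctan (u / σ) / σ := by
  have hderiv : ∀ v : ℝ, HasDerivAt (fun v : ℝ ↦ Real.arctan (v / σ) / σ) (1 / (σ ^ 2 + v ^ 2)) v := by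
    intro v
    have h1 : HasDerivAt (fun v : ℝ ↦ v / σ) (1 / σ) v := by
      simpa using (hasDerivAt_id v).div_const σ
    have h2 := (h1.arctan).div_const σ
    refine h2.congr_deriv ?_
    have hσ0 : σ ≠ 0 := hσ.ne'
    have hden : σ ^ 2 + v ^ 2 ≠ 0 := by positivity
    field_simp
  have hcont : Continuous fun v : ℝ ↦ 1 / (σ ^ 2 + v ^ 2) := by
    refine continuous_const.div (by fun_prop) fun v ↦ ?_
    positivity
  have h := intervalIntegral.integral_eq_sub_of_hasDerivAt (a := 0) (b := u)
    (fun v _ ↦ hderiv v) (hcont.intervalIntegrable _ _)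
  simpa using h

/-! ## The theorem -/

/-- **Complex Stirling formula with phase on `Re s ≥ 1`**: there is `E` with `‖E‖ ≤ 1/‖s‖` and
`Γ(s) = √(2π) exp((s − ½) Log s − s + E)`. (Whittaker–Watson §12.33/§13.6 give
`log Γ(s) = (s − ½) log s − s + ½ log 2π + O(1/|s|)` uniformly on `|arg s| ≤ π − δ`; this is the
sector `|arg s| < π/2`, `Re s ≥ 1`, with an explicit constant.) [cite: WhittakerWatson1927, §12.33] -/
theorem exists_Gamma_eq_exp_stirling_of_one_le_re {s : ℂ} (hs : 1 ≤ s.re) :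
    ∃ E : ℂ, ‖E‖ ≤ 1 / ‖s‖ ∧
      Gamma s = (Real.sqrt (2 * π) : ℂ) * exp ((s - 1 / 2) * log s - s + E) := by
  have hs0 : 0 < s.re := by linarith
  have hsn : 1 ≤ ‖s‖ := hs.trans ((le_abs_self _).trans (abs_re_le_norm s))
  have hsn0 : 0 < ‖s‖ := by linarith
  have hπ3 : 3 < π := Real.pi_gt_three
  have hπ4 : π < 4 := Real.pi_lt_four
  by_cases hA : ‖s‖ / 2 ≤ |s.im|
  · ----------------------------------------------------------------
    -- Region A: away from the real axis — the upper-half-plane form (and its conjugate)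
    ----------------------------------------------------------------
    have him2 : ‖s‖ / 4 ≤ s.im ^ 2 := by
      have h1 : ‖s‖ ^ 2 / 4 ≤ s.im ^ 2 := by
        have := pow_le_pow_left₀ (by positivity) hA 2
        rw [sq_abs] at this
        linarith [this]
      nlinarith
    have hbound : 1 / (12 * ‖s‖) + (π + 1) / (16 * π * s.im ^ 2) ≤ 1 / ‖s‖ := by
      have h1 : (π + 1) / (16 * π * s.im ^ 2) ≤ (π + 1) / (4 * π * ‖s‖) := by
        apply div_le_div_of_nonneg_left (by positivity) (by positivity)
        nlinarith
      have hc : 1 / 12 + (π + 1) / (4 * π) ≤ 1 := by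
        have : (π + 1) / (4 * π) ≤ 11 / 12 := by
          rw [div_le_iff₀ (by positivity)]; nlinarith
        linarith
      have h2 : 1 / (12 * ‖s‖) + (π + 1) / (4 * π * ‖s‖) ≤ 1 / ‖s‖ := by
        have e : 1 / (12 * ‖s‖) + (π + 1) / (4 * π * ‖s‖) = (1 / 12 + (π + 1) / (4 * π)) / ‖s‖ := by
          field_simp
        rw [e]
        exact div_le_div_of_nonneg_right hc hsn0.le
      linarith
    rcases le_or_gt 0 s.im with him | him
    · -- `Im s > 0`
      have him' : 0 < s.im := by
        rcases him.eq_or_lt with h | h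
        · exfalso; rw [← h] at hA; simp at hA; linarith
        · exact h
      obtain ⟨E, hE, hΓ⟩ := exists_Gamma_eq_exp_stirling him'
      exact ⟨E, hE.trans hbound, hΓ⟩
    · -- `Im s < 0`: conjugate
      have himc : 0 < (conj s).im := by simpa using him
      obtain ⟨E, hE, hΓ⟩ := exists_Gamma_eq_exp_stirling himc
      refine ⟨conj E, ?_, ?_⟩
      · rw [Complex.norm_conj]
        refine hE.trans ?_
        have : (conj s).im ^ 2 = s.im ^ 2 := by simp
        rw [Complex.norm_conj, this]
        exact hbound
      · have harg : s.arg ≠ π := by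
          intro h
          have := Complex.arg_eq_pi_iff.1 h
          linarith [this.1]
        have hlog : log (conj s) = conj (log s) := by
          rw [Complex.log_conj_eq_ite, if_neg harg]
        have h := congrArg conj hΓ
        rw [Complex.Gamma_conj, conj_conj] at h
        rw [h, map_mul, Complex.conj_ofReal, ← Complex.exp_conj]
        congr 2
        have h12 : conj ((1 : ℂ) / 2) = 1 / 2 := by
          rw [map_div₀, map_one, map_ofNat]
        simp only [map_add, map_sub, map_mul, Complex.conj_conj, hlog, h12]
  · ----------------------------------------------------------------
    -- Region B: near the real axis — integrate `ψ` up from the real point `σ`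
    ----------------------------------------------------------------
    rw [not_le] at hA
    set σ : ℝ := s.re with hσ_def
    set τ : ℝ := s.im with hτ_def
    have hσ1 : 1 ≤ σ := hs
    have hσ0 : 0 < σ := hs0
    have hσs : ‖s‖ / 2 < σ := by
      have h1 : ‖s‖ ^ 2 = σ ^ 2 + τ ^ 2 := by
        rw [← Complex.normSq_eq_norm_sq, Complex.normSq_apply, hσ_def, hτ_def]; ring
      have h2 : τ ^ 2 < ‖s‖ ^ 2 / 4 := by
        have := abs_lt.1 (show |τ| < ‖s‖ / 2 from hA)
        nlinarith [this.1, this.2]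
      nlinarith
    have hs_eq : s = (σ : ℂ) + τ * I := by
      rw [hσ_def, hτ_def]; exact (re_add_im s).symm.trans (by simp [mul_comm])
    -- the pieces
    set ψv : ℝ → ℂ := fun v ↦ digamma ((σ : ℂ) + v * I) with hψv
    set mv : ℝ → ℂ := fun v ↦ log ((σ : ℂ) + v * I) - 1 / (2 * ((σ : ℂ) + v * I)) with hmv
    have hψc : Continuous ψv := continuous_digamma_vertical hσ0
    have hmc : Continuous mv := by
      have hline : Continuous fun v : ℝ ↦ (σ : ℂ) + v * I := by fun_prop
      have hslit : ∀ v : ℝ, (σ : ℂ) + v * I ∈ slitPlane := fun v ↦ Or.inl (by simpa using hσ0)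
      have hne : ∀ v : ℝ, (σ : ℂ) + v * I ≠ 0 := fun v ↦ slitPlane_ne_zero (hslit v)
      exact (Continuous.clog hline hslit).sub (continuous_const.div (continuous_const.mul hline)
        fun v ↦ mul_ne_zero two_ne_zero (hne v))
    have hΓ := Gamma_vertical_eq_mul_exp_integral hσ0 τ
    have hM := stirlingMain_vertical_eq_integral hσ0 τ
    rw [← hs_eq] at hΓ hM
    -- the real anchor
    have hΓσ_pos : 0 < Real.Gamma σ := Real.Gamma_pos_of_pos hσ0
    have hΓσ : Gamma (σ : ℂ) = ((Real.Gamma σ : ℝ) : ℂ) := (Complex.Gamma_ofReal σ)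
    have hanchor := abs_log_norm_Gamma_sub_le (w := (σ : ℂ)) (by simpa using hσ0)
    have hnormσ : ‖(σ : ℂ)‖ = σ := by rw [Complex.norm_real, Real.norm_eq_abs, abs_of_pos hσ0]
    rw [hΓσ, Complex.norm_real, Real.norm_eq_abs, abs_of_pos hΓσ_pos, hnormσ, Complex.ofReal_re,
      Complex.ofReal_im, zero_mul, sub_zero] at hanchor
    set Er : ℝ := Real.log (Real.Gamma σ) -
      ((σ - 1 / 2) * Real.log σ - σ + Real.log (2 * π) / 2) with hEr
    have hEr_le : |Er| ≤ 1 / 12 * (1 / σ ^ 2 + π / (2 * σ)) := hanchor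
    -- the error integral
    set Ei : ℂ := I * ∫ v in (0 : ℝ)..τ, (ψv v - mv v) with hEi
    have hEi_le : ‖Ei‖ ≤ (1 / (4 * π) + 1 / 12) * (π / (2 * σ)) := by
      set K : ℝ := 1 / (4 * π) + 1 / 12 with hK_def
      have hK : 0 ≤ K := by positivity
      have hpt : ∀ v : ℝ, ‖ψv v - mv v‖ ≤ K * (1 / (σ ^ 2 + v ^ 2)) := by
        intro v
        have hre : 1 ≤ ((σ : ℂ) + v * I).re := by simpa using hσ1
        have h := norm_digamma_sub_log_add_inv_le hre
        have hn : ‖(σ : ℂ) + v * I‖ ^ 2 = σ ^ 2 + v ^ 2 := by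
          rw [← Complex.normSq_eq_norm_sq, Complex.normSq_apply]; simp; ring
        rw [hn] at h
        have e : K * (1 / (σ ^ 2 + v ^ 2)) = (1 / (4 * π) + 1 / 12) / (σ ^ 2 + v ^ 2) := by
          rw [hK_def]; ring
        rw [e]
        exact h
      have hg : IntervalIntegrable (fun v : ℝ ↦ K * (1 / (σ ^ 2 + v ^ 2))) volume 0 τ := by
        refine (Continuous.intervalIntegrable ?_ _ _)
        refine continuous_const.mul (continuous_const.div (by fun_prop) fun v ↦ ?_)
        positivity
      have h1 := intervalIntegral.norm_integral_le_abs_of_norm_le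
        (Filter.Eventually.of_forall fun v ↦ hpt v) hg
      rw [intervalIntegral.integral_const_mul, integral_inv_sq_add_sq hσ0] at h1
      have harc : |Real.arctan (τ / σ) / σ| ≤ π / (2 * σ) := by
        rw [abs_div, abs_of_pos hσ0, div_le_div_iff₀ hσ0 (by positivity)]
        have h1 := Real.arctan_lt_pi_div_two (τ / σ)
        have h2 := Real.neg_pi_div_two_lt_arctan (τ / σ)
        have : |Real.arctan (τ / σ)| ≤ π / 2 := abs_le.2 ⟨by linarith, h1.le⟩
        nlinarith
      calc ‖Ei‖ = ‖∫ v in (0 : ℝ)..τ, (ψv v - mv v)‖ := by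
            rw [hEi, norm_mul, Complex.norm_I, one_mul]
        _ ≤ |K * (Real.arctan (τ / σ) / σ)| := h1
        _ = K * |Real.arctan (τ / σ) / σ| := by rw [abs_mul, abs_of_nonneg hK]
        _ ≤ K * (π / (2 * σ)) := mul_le_mul_of_nonneg_left harc hK
    -- assemble
    refine ⟨(Er : ℂ) + Ei, ?_, ?_⟩
    · -- the bound
      have h1 : ‖(Er : ℂ) + Ei‖ ≤ |Er| + ‖Ei‖ := by
        refine (norm_add_le _ _).trans ?_
        rw [Complex.norm_real, Real.norm_eq_abs]
      have h2 : |Er| + ‖Ei‖ ≤ 1 / 12 * (1 / σ ^ 2 + π / (2 * σ)) +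
          (1 / (4 * π) + 1 / 12) * (π / (2 * σ)) := add_le_add hEr_le hEi_le
      have h3 : 1 / 12 * (1 / σ ^ 2 + π / (2 * σ)) + (1 / (4 * π) + 1 / 12) * (π / (2 * σ)) ≤
          1 / (2 * σ) := by
        have e1 : 1 / σ ^ 2 ≤ 1 / σ := by
          rw [div_le_div_iff₀ (by positivity) hσ0]; nlinarith
        have e2 : (1 / (4 * π) + 1 / 12) * (π / (2 * σ)) = 1 / (8 * σ) + π / (24 * σ) := by
          field_simp; ring
        rw [e2]
        have : 1 / 12 * (1 / σ ^ 2 + π / (2 * σ)) ≤ 1 / 12 * (1 / σ + π / (2 * σ)) := by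
          gcongr
        refine (add_le_add this le_rfl).trans ?_
        rw [show 1 / 12 * (1 / σ + π / (2 * σ)) + (1 / (8 * σ) + π / (24 * σ)) =
          (1 / 12 + π / 24 + 1 / 8 + π / 24) / σ by field_simp; ring]
        rw [div_le_div_iff₀ hσ0 (by positivity)]
        have hπ' : π < 3.15 := Real.pi_lt_d2
        nlinarith
      have h4 : 1 / (2 * σ) ≤ 1 / ‖s‖ := by
        rw [div_le_div_iff₀ (by positivity) hsn0]; linarith
      linarith
    · -- the identity
      have hexpσ : Gamma (σ : ℂ) = exp ((Real.log (Real.Gamma σ) : ℝ) : ℂ) := by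
        rw [hΓσ, ← Complex.ofReal_exp, Real.exp_log hΓσ_pos]
      have hsqrt : (Real.sqrt (2 * π) : ℂ) = exp (((Real.log (2 * π) / 2 : ℝ)) : ℂ) := by
        rw [← Complex.ofReal_exp]
        congr 1
        rw [Real.sqrt_eq_rpow, Real.rpow_def_of_pos (by positivity)]
        congr 1; ring
      -- split the `ψ` integral into main part + error
      have hint_split : (∫ v in (0 : ℝ)..τ, ψv v) =
          (∫ v in (0 : ℝ)..τ, mv v) + ∫ v in (0 : ℝ)..τ, (ψv v - mv v) := by
        rw [intervalIntegral.integral_sub (hψc.intervalIntegrable _ _) (hmc.intervalIntegrable _ _)]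
        ring
      rw [hΓ, hexpσ, ← Complex.exp_add, hsqrt, ← Complex.exp_add]
      congr 1
      rw [hint_split, mul_add, ← hM]
      simp only [hEr, hEi, hψv, hmv]
      push_cast
      have hlogσ : log (σ : ℂ) = ((Real.log σ : ℝ) : ℂ) := (Complex.ofReal_log hσ0.le).symm
      rw [hlogσ]
      ring

end Literature.Analysis.SpecialFunctions.GammaStirling

end
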